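import Literature.MathematicalPhysics.QuantumFieldTheory.Balaban1983to89.B9Eq395Small

/-!
# `Balaban1983to89.B9Thm39CinvSmallSums` — [Balaban1985BackgroundPropagators] (3.95) pp. 411–412, THE SECOND AND THIRD SUMS AT A GENERAL BLOCK MAP:
# the third sum «already localized and give small factors O(M⁻¹)» and the (3.97) factor «the usual factors multiplied by e^{−2δ₀M}» — the cell's
# kernel-checked scalar estimates (`B9Eq395Small.thirdSum_term_majorant` / `thirdSum_majorant` / `smallFactor_term_majorant` / `term397_majorant`,
# block map = identity on 𝔅) re-run with `blk : X → 𝔅`, for def-Y's `𝔸`-valued block carrier (cell `lit-balaban`, G-B9-LETTERS module M5.6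
# FILE 5a, seat p21 gen 32)

statement-level skeleton of published theorems with citation tags; proofs where landed; nothing here is a claim about the Yang–Mills mass gap

CITATION HEADER (lean-in-tree rule).  B9 = T. Bałaban, *Propagators for lattice gauge theories in a background field*, Commun. Math. Phys. **99** (1985)
389–434 (journal page = PDF page + 388; held `paper:balaban1985-cmp99-background-propagators`, pp. 411–412 re-read by this seat 2026-08-28).  p. 411
(3.95) «Q′G′²Q′*C₀ = I + Σ_□(1 − □̃)Q′G′²Q′*h_□C_□h_□ + Σ_□ □̃Q′(G′² − G′²_□)Q′*h_□C_□h_□ + Σ_□[□̃Q′G′²_□Q′*, h_□]C_□h_□ = I − R», «By the same estimates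
as in [4], especially (2.83)–(2.85), we can see that the operator R is small»; p. 412 «We take the second term together with the term in the second sum …
□̃Q′(G′²_{□₀} − G′²_□)Q′*h_□C_□h_□. (3.97)  We have proved in [2] that if we have a difference of propagators defined on two domains, then in an estimate of
this difference we have, besides the usual factors connected with propagators of a considered type, an exponential factor with a distance between
localizations and a closest point where a change was made. … can be estimated by the usual factors multiplied by e^{−2δ₀M} … This exponential can be
estimated by (2δ₀M)⁻¹ … Finally let us notice that terms in the third sum on the right-hand side of (3.95) are already localized and give small factors
O(M⁻¹).»  [4] = [Balaban1984PropagatorsII] T. Bałaban, *Propagators and renormalization transformations for lattice gauge theories. II*, Commun. Math.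
Phys. **96** (1984) 223–250: (2.51)–(2.54) pp. 232–233, (2.60)–(2.61) p. 234, (2.83)–(2.85) pp. 237–238.  Rows B9.Eq3.95 × B9.Eq3.97 × B4.Eq2.84 ×
B4.Eq2.85 (cells only; no row head changes).

WHY THIS FILE (M5.6 = [B9] Thm 3.9 ⇒ Thm 3.2 (3.48) for `C(U) = (Q′G′²Q′*)⁻¹(U)`).  FILE 1 (`B9Thm39CinvTorusRegular.hasMajorant_conj_Cinv_of_cubes`) displays
the three (2.85)-shape majorants `hR₁`, `hR₂`, `hR₃` of the three sums of (3.95), read on def-Y's block carrier `BlkY i × ι` with the block map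
`(s, j) ↦ ιB s`.  FILE 2 (`B9Thm39CinvFirstSum`) re-ran the cell's first-sum estimate at a general block map.  The cell (`B9Eq395Small`, sub-cell B09
gen 6) kernel-checked the THIRD sum and the (3.97) FACTOR of the second sum as well — on SCALAR functions on 𝔅 with the identity block map.  THIS FILE is
their re-run with `blk : X → 𝔅` in place of the identity: same hypotheses, same constants, same proofs line by line (the cell's generic lemmas
`hasMajorant_comm_mulOp`, `hasMajorant_mul_mulOp_right`, `conv_majorant`, `hasMajorant_mulOp_left`, `localizedSum_majorant`, `thirdSum_term_eq` were
already stated for a general block map and are USED BY NAME).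

WHAT IS PROVED (all `theorem`s, 0 `def`, 0 sorry, 0 new named facts).
* §1 ★★ `thirdSum_term_majorant_blk` — the □-term `(□̃L_□h_□ − h_□□̃L_□)C_□h_□ = □̃[L_□, h_□]C_□h_□` of the third sum: with `L_□ ≺ κP(a)⁻¹e^{−a_Lδ₀d}`
  (`hL`), `C_□ ≺ B₀P(a)e^{−bδ₀d}` (`hCl`, (3.48) for `C_□`), `|□̃| ≦ 1`, `|h_□| ≦ 1`, `supp h_□ ⊂ S_□` through `blk`, `h_□` `(ℓ₀, ℓ₁)`-slowly varying in
  `d(blk ·, blk ·)` (`hLip`), scale transfer at `α_st`, (2.61) at `b − ρ`, `α_st + α_c + ρ ≦ a_L`: majorant `1_{S_□}(a′)·Θ₃·e^{−ρδ₀d(a,a′)}`,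
  `Θ₃ = (ℓ₀ + ℓ₁(α_cδ₀)⁻¹)κB₀C·c₁(δ₀, b−ρ)`;  ★ `thirdSum_majorant_blk` — summed over □ with source-side overlap `≦ N`: `N·Θ₃·e^{−ρδ₀d}` ((2.85)-shape;
  `B9Eq395Small.thirdSum_small_factor` gives `Θ₃ = O(M⁻¹)` for `ℓ₀, ℓ₁ = O(M⁻¹)` BY NAME).
* §2 ★★ `smallFactor_term_majorant_blk` — a factor `□̃·A·h_□C_□h_□` with a small middle letter `A ≺ θP(a)⁻¹e^{−a_Aδ₀d}` (`hA` DISPLAYED): majorant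
  `1_{S_□}(a′)·θB₀C·c₁(δ₀, b−ρ)·e^{−ρδ₀d}`;  ★★ `term397_majorant_blk` — the (3.97) term with the [2]-difference majorant DISPLAYED as `hD`
  (`κ_D·e^{−2δ₀D_sep}·P(a)⁻¹e^{−a_Dδ₀d}`, cell GAPS G-B9-05);  ★ `secondSum_majorant_blk` — summed over □: `N·(κ_De^{−2δ₀D_sep}B₀Cc₁)·e^{−ρδ₀d}`
  (`B9Eq395Small.term397_small_factor`: `e^{−2δ₀D_sep} ≦ (2δ₀M)⁻¹` for `D_sep ≧ M`, BY NAME).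

HONEST SCOPE.  Bookkeeping over [4]'s block-majorant calculus (pv08 `B6RandomWalk`, the cell's `B9Eq395Small` §0–§1); every analytic input is a hypothesis
of the printed shape: `hL` ((2.83) line 1 for `L_□ = Q′G′²_□Q′*` — M5.5 + M5.6 FILES 3a/3b at the member), `hCl` ((3.48) for `C_□`, p. 409 — the cube
letters' Cor. 3.6, M5.2-E), `hLip` (slow variation of `h_□` in the multiscale distance — cell GAPS G-pv08-1 / C-B9-21 residual), `hD` (the [2]-difference
estimate for `Q′(G′² − G′²_□)Q′*`, GAP G-B9-05 — NOT derived anywhere in the tree), scale transfer / (2.61) / (2.54) / symmetry / `d ≧ 0`.  Nothing of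
[B9]/[4]/[2] asserted beyond what is proved; NOT summit progress.  RELATED, NOT DUPLICATED (searched 2026-08-28 `lean search
'thirdSum_term_majorant|term397_majorant|smallFactor_term_majorant' --decl` = the cell's identity-block-map originals only): `B9Eq395Small` (block map =
identity; the special case `blk = id` of every theorem here), `B9Eq395Hom` (the p. 412 commutator factor through two lattices, scalar block carrier),
`B9Thm39CinvFirstSum` (the first sum at a general block map, M5.6 FILE 2).
-/

namespace Literature.MathematicalPhysics.QuantumFieldTheory.Balaban1983to89.B9Thm39CinvSmallSums

open Literature.MathematicalPhysics.QuantumFieldTheory.Balaban1983to89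
open Finset B9Thm37Sum

variable {g : B9.Geometry} [Fintype g.Site] [DecidableEq g.Site] {R : ℝ} {H : Prop} {X : Type}

/-! ## §1 The third sum of (3.95) at a general block map: «already localized and give small factors O(M⁻¹)» -/

/-- ★★ **THE □-TERM OF THE THIRD SUM OF (3.95), AT A GENERAL BLOCK MAP** — the cell's `B9Eq395Small.thirdSum_term_majorant` with `blk : X → 𝔅` for the
identity: `(□̃L_□h_□ − h_□□̃L_□)C_□h_□ = □̃[L_□, h_□]C_□h_□` has the majorant `1_{S_□}(a′)·(ℓ₀ + ℓ₁(α_cδ₀)⁻¹)κB₀C·c₁(δ₀, b−ρ)·e^{−ρδ₀d(a,a′)}` under the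
displayed inputs `hL` (`L_□ ≺ κP⁻¹e^{−a_Lδ₀d}`), `hCl` ((3.48) for `C_□`), `|□̃| ≦ 1`, `|h_□| ≦ 1`, `supp h_□ ⊂ S_□`, `hLip` (slow variation of `h_□` in
`d(blk ·, blk ·)`), scale transfer at `α_st`, (2.61) at `b − ρ`, `α_st + α_c + ρ ≦ a_L`; same constants, same proof.
[cite: Balaban1985BackgroundPropagators, (3.95) p.411 + p.412 («already localized and give small factors O(M⁻¹)»); Balaban1984PropagatorsII, (2.52) p.232 + (2.61) p.234] -/
theorem thirdSum_term_majorant_blk (blk : X → g.Site) (d : ℕ) (δ₀ aL αc αst ρ b κ ℓ₀ ℓ₁ B₀ C : ℝ) (P : g.Site → ℝ) (S : Finset g.Site)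
    (χ h : X → ℝ)
    (hκ : 0 ≤ κ) (hℓ₀ : 0 ≤ ℓ₀) (hℓ₁ : 0 ≤ ℓ₁) (hB₀ : 0 ≤ B₀) (hC : 0 ≤ C) (hP : ∀ y, 0 < P y) (hδ₀ : 0 ≤ δ₀)
    (hαc : 0 < αc * δ₀) (hρ : 0 ≤ ρ) (hsplit : αst + αc + ρ ≤ aL)
    (htri : B6RandomWalk.Triangle254 (B9Thm34Ext.toB6 g R H)) (hsymm : ∀ a b : g.Site, g.dist a b = g.dist b a)
    (hdnn : ∀ a b : g.Site, 0 ≤ g.dist a b)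
    (hST : B9Ineq347.ScaleTransfer g δ₀ αst C P)
    (h261 : B6RandomWalk.Ineq261 d (B9Thm34Ext.toB6 g R H) δ₀ (b - ρ))
    (hχ1 : ∀ x, |χ x| ≤ 1) (hh1 : ∀ x, |h x| ≤ 1) (hhS : ∀ x, h x ≠ 0 → blk x ∈ S)
    (hLip : ∀ x x' : X, |h x' - h x| ≤ ℓ₀ + ℓ₁ * g.dist (blk x) (blk x'))
    {Lloc Cl : Module.End ℝ (X → ℝ)}
    (hL : B6RandomWalk.HasMajorant (g := B9Thm34Ext.toB6 g R H) blk Lloc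
      (fun (a y'' : g.Site) => κ * (P a)⁻¹ * Real.exp (-(aL * δ₀ * g.dist a y''))))
    (hCl : B6RandomWalk.HasMajorant (g := B9Thm34Ext.toB6 g R H) blk Cl
      (fun (y'' b' : g.Site) => B₀ * P y'' * Real.exp (-(b * δ₀ * g.dist y'' b')))) :
    B6RandomWalk.HasMajorant (g := B9Thm34Ext.toB6 g R H) blk
      ((mulOp χ * Lloc * mulOp h - mulOp h * (mulOp χ * Lloc)) * Cl * mulOp h)
      (fun (a b' : g.Site) => (if b' ∈ S then (1 : ℝ) else 0) *
        ((ℓ₀ + ℓ₁ * (αc * δ₀)⁻¹) * κ * B₀ * C * B6.c1 d δ₀ (b - ρ)) * Real.exp (-(ρ * δ₀ * g.dist a b'))) := by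
  rw [B9Eq395Small.thirdSum_term_eq]
  -- the commutator [L_□, h_□]
  have hcomm := B9Eq395Small.hasMajorant_comm_mulOp (G := B9Thm34Ext.toB6 g R H) blk hL h ℓ₀ ℓ₁ hℓ₀ hℓ₁ hdnn hLip
  -- absorb the slowly varying weight into the exponential
  have hcomm' : B6RandomWalk.HasMajorant (g := B9Thm34Ext.toB6 g R H) blk (Lloc * mulOp h - mulOp h * Lloc)
      (fun (a y'' : g.Site) => (ℓ₀ + ℓ₁ * (αc * δ₀)⁻¹) * κ * (P a)⁻¹ *
        Real.exp (-((aL - αc) * δ₀ * g.dist a y''))) := by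
    refine B6RandomWalk.hasMajorant_mono (g := B9Thm34Ext.toB6 g R H) _ hcomm fun (a y'' : g.Site) => ?_
    have h1 := B9Eq395Small.lin_mul_exp_le ℓ₀ ℓ₁ aL αc δ₀ (g.dist a y'') hℓ₀ hℓ₁ hαc (hdnn a y'')
    have h2 : 0 ≤ κ * (P a)⁻¹ := mul_nonneg hκ (inv_nonneg.mpr (hP a).le)
    calc (ℓ₀ + ℓ₁ * g.dist a y'') * (κ * (P a)⁻¹ * Real.exp (-(aL * δ₀ * g.dist a y'')))
        = κ * (P a)⁻¹ * ((ℓ₀ + ℓ₁ * g.dist a y'') * Real.exp (-(aL * δ₀ * g.dist a y''))) := by ring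
      _ ≤ κ * (P a)⁻¹ * ((ℓ₀ + ℓ₁ * (αc * δ₀)⁻¹) * Real.exp (-((aL - αc) * δ₀ * g.dist a y''))) :=
          mul_le_mul_of_nonneg_left h1 h2
      _ = _ := by ring
  -- C_□h_□, localized at the source
  have hClh := B9Eq395Small.hasMajorant_mul_mulOp_right (R := R) (H := H) blk hCl h hh1 S (fun x hx => hhS x hx)
  -- the y″-sum
  have hconv := B9Eq395Small.conv_majorant (R := R) (H := H) blk d δ₀ (aL - αc) αst ρ b
    ((ℓ₀ + ℓ₁ * (αc * δ₀)⁻¹) * κ) B₀ C P S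
    (mul_nonneg (add_nonneg hℓ₀ (mul_nonneg hℓ₁ (inv_nonneg.mpr hαc.le))) hκ) hB₀ hC hP hδ₀ hρ (by linarith)
    htri hsymm hdnn hST h261 hcomm' hClh
  -- the cut-off □̃ in front
  have hcut := B9Eq395Small.hasMajorant_mulOp_left (G := B9Thm34Ext.toB6 g R H) blk hconv χ hχ1
  refine B6RandomWalk.hasMajorant_mono (g := B9Thm34Ext.toB6 g R H) _ hcut fun (a b' : g.Site) => ?_
  exact le_of_eq (by ring)

/-- ★ **THE THIRD SUM OF (3.95) IS (2.85)-SMALL, AT A GENERAL BLOCK MAP**: summed over □ with source-side overlap `≦ N`, majorant `N·Θ₃·e^{−ρδ₀d(a,a′)}`,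
`Θ₃ = (ℓ₀ + ℓ₁(α_cδ₀)⁻¹)κB₀Cc₁(δ₀, b−ρ)` (= `O(M⁻¹)` for `ℓ₀, ℓ₁ = O(M⁻¹)`: `B9Eq395Small.thirdSum_small_factor`). The cell's `thirdSum_majorant` with
`blk`. [cite: Balaban1985BackgroundPropagators, (3.95) p.411 + p.412; Balaban1984PropagatorsII, (2.85) p.238] -/
theorem thirdSum_majorant_blk (blk : X → g.Site) (d : ℕ) (δ₀ aL αc αst ρ b κ ℓ₀ ℓ₁ B₀ C N : ℝ) (P : g.Site → ℝ) {ι : Type} [Fintype ι]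
    (S : ι → Finset g.Site) (χ h : ι → X → ℝ)
    (hκ : 0 ≤ κ) (hℓ₀ : 0 ≤ ℓ₀) (hℓ₁ : 0 ≤ ℓ₁) (hB₀ : 0 ≤ B₀) (hC : 0 ≤ C) (hP : ∀ y, 0 < P y) (hδ₀ : 0 ≤ δ₀)
    (hαc : 0 < αc * δ₀) (hρ : 0 ≤ ρ) (hsplit : αst + αc + ρ ≤ aL)
    (htri : B6RandomWalk.Triangle254 (B9Thm34Ext.toB6 g R H)) (hsymm : ∀ a b : g.Site, g.dist a b = g.dist b a)
    (hdnn : ∀ a b : g.Site, 0 ≤ g.dist a b)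
    (hST : B9Ineq347.ScaleTransfer g δ₀ αst C P)
    (h261 : B6RandomWalk.Ineq261 d (B9Thm34Ext.toB6 g R H) δ₀ (b - ρ))
    (hχ1 : ∀ i x, |χ i x| ≤ 1) (hh1 : ∀ i x, |h i x| ≤ 1) (hhS : ∀ i x, h i x ≠ 0 → blk x ∈ S i)
    (hLip : ∀ i (x x' : X), |h i x' - h i x| ≤ ℓ₀ + ℓ₁ * g.dist (blk x) (blk x'))
    (hcnt : ∀ b' : g.Site, (∑ i, if b' ∈ S i then (1 : ℝ) else 0) ≤ N)
    (Lloc Cl : ι → Module.End ℝ (X → ℝ))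
    (hL : ∀ i, B6RandomWalk.HasMajorant (g := B9Thm34Ext.toB6 g R H) blk (Lloc i)
      (fun (a y'' : g.Site) => κ * (P a)⁻¹ * Real.exp (-(aL * δ₀ * g.dist a y''))))
    (hCl : ∀ i, B6RandomWalk.HasMajorant (g := B9Thm34Ext.toB6 g R H) blk (Cl i)
      (fun (y'' b' : g.Site) => B₀ * P y'' * Real.exp (-(b * δ₀ * g.dist y'' b')))) :
    B6RandomWalk.HasMajorant (g := B9Thm34Ext.toB6 g R H) blk
      (∑ i, (mulOp (χ i) * Lloc i * mulOp (h i) - mulOp (h i) * (mulOp (χ i) * Lloc i)) * Cl i * mulOp (h i))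
      (fun (a b' : g.Site) => N * (((ℓ₀ + ℓ₁ * (αc * δ₀)⁻¹) * κ * B₀ * C * B6.c1 d δ₀ (b - ρ)) *
        Real.exp (-(ρ * δ₀ * g.dist a b')))) :=
  B9Eq395Small.localizedSum_majorant (R := R) (H := H) blk ρ δ₀ _ N S _
    (mul_nonneg (mul_nonneg (mul_nonneg (mul_nonneg
      (add_nonneg hℓ₀ (mul_nonneg hℓ₁ (inv_nonneg.mpr hαc.le))) hκ) hB₀) hC) (B6RandomWalk.c1_nonneg d δ₀ _))
    (fun i => thirdSum_term_majorant_blk blk d δ₀ aL αc αst ρ b κ ℓ₀ ℓ₁ B₀ C P (S i) (χ i) (h i) hκ hℓ₀ hℓ₁ hB₀ hC hP hδ₀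
      hαc hρ hsplit htri hsymm hdnn hST h261 (hχ1 i) (hh1 i) (hhS i) (hLip i) (hL i) (hCl i)) hcnt

/-! ## §2 The second sum of (3.95): the (3.97) factor with its [2]-difference majorant displayed, at a general block map -/

/-- ★★ **A FACTOR `□̃·A·h_□C_□h_□` WITH A SMALL MIDDLE LETTER, AT A GENERAL BLOCK MAP** — the cell's `B9Eq395Small.smallFactor_term_majorant` with `blk`:
`A ≺ θP(a)⁻¹e^{−a_Aδ₀d}` (DISPLAYED `hA`: `A = Q′(G′² − G′²_□)Q′*` with `θ = κ_De^{−2δ₀M}`, or the p. 412 commutator factor with `θ = O(M⁻¹)`), `C_□`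
obeying (3.48) (`hCl`), `|□̃| ≦ 1`, `|h_□| ≦ 1`, `supp h_□ ⊂ S_□` through `blk`, `α_st + ρ ≦ a_A` with the scale-transfer / (2.61) / (2.54) inputs ⟹
majorant `1_{S_□}(a′)·θB₀C·c₁(δ₀, b−ρ)·e^{−ρδ₀d(a,a′)}`. [cite: Balaban1985BackgroundPropagators, p.412 + (3.97); Balaban1984PropagatorsII, (2.52) p.232 + (2.61) p.234] -/
theorem smallFactor_term_majorant_blk (blk : X → g.Site) (d : ℕ) (δ₀ aA αst ρ b θ B₀ C : ℝ) (P : g.Site → ℝ) (S : Finset g.Site)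
    (χ h : X → ℝ)
    (hθ : 0 ≤ θ) (hB₀ : 0 ≤ B₀) (hC : 0 ≤ C) (hP : ∀ y, 0 < P y) (hδ₀ : 0 ≤ δ₀) (hρ : 0 ≤ ρ) (hsplit : αst + ρ ≤ aA)
    (htri : B6RandomWalk.Triangle254 (B9Thm34Ext.toB6 g R H)) (hsymm : ∀ a b : g.Site, g.dist a b = g.dist b a)
    (hdnn : ∀ a b : g.Site, 0 ≤ g.dist a b)
    (hST : B9Ineq347.ScaleTransfer g δ₀ αst C P)
    (h261 : B6RandomWalk.Ineq261 d (B9Thm34Ext.toB6 g R H) δ₀ (b - ρ))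
    (hχ1 : ∀ x, |χ x| ≤ 1) (hh1 : ∀ x, |h x| ≤ 1) (hhS : ∀ x, h x ≠ 0 → blk x ∈ S)
    {A Cl : Module.End ℝ (X → ℝ)}
    (hA : B6RandomWalk.HasMajorant (g := B9Thm34Ext.toB6 g R H) blk A
      (fun (a y'' : g.Site) => θ * (P a)⁻¹ * Real.exp (-(aA * δ₀ * g.dist a y''))))
    (hCl : B6RandomWalk.HasMajorant (g := B9Thm34Ext.toB6 g R H) blk Cl
      (fun (y'' b' : g.Site) => B₀ * P y'' * Real.exp (-(b * δ₀ * g.dist y'' b')))) :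
    B6RandomWalk.HasMajorant (g := B9Thm34Ext.toB6 g R H) blk
      (mulOp χ * A * (mulOp h * Cl * mulOp h))
      (fun (a b' : g.Site) => (if b' ∈ S then (1 : ℝ) else 0) * (θ * B₀ * C * B6.c1 d δ₀ (b - ρ)) *
        Real.exp (-(ρ * δ₀ * g.dist a b'))) := by
  -- h_□C_□h_□ localized at the source (the h_□ in front only costs |h_□| ≦ 1)
  have hT : B6RandomWalk.HasMajorant (g := B9Thm34Ext.toB6 g R H) blk (mulOp h * Cl * mulOp h)
      (fun (y'' b' : g.Site) => (if b' ∈ S then (1 : ℝ) else 0) *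
        (B₀ * P y'' * Real.exp (-(b * δ₀ * g.dist y'' b')))) := by
    rw [mul_assoc]
    exact B9Eq395Small.hasMajorant_mulOp_left (G := B9Thm34Ext.toB6 g R H) blk
      (B9Eq395Small.hasMajorant_mul_mulOp_right (R := R) (H := H) blk hCl h hh1 S (fun x hx => hhS x hx)) h hh1
  have hconv := B9Eq395Small.conv_majorant (R := R) (H := H) blk d δ₀ aA αst ρ b θ B₀ C P S hθ hB₀ hC hP hδ₀ hρ
    hsplit htri hsymm hdnn hST h261 hA hT
  rw [mul_assoc]
  exact B9Eq395Small.hasMajorant_mulOp_left (G := B9Thm34Ext.toB6 g R H) blk hconv χ hχ1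

/-- ★★ **THE (3.97) TERM AT A GENERAL BLOCK MAP** — the cell's `B9Eq395Small.term397_majorant` with `blk`: if the difference letter `D = Q′(G′² − G′²_□)Q′*` has
the majorant `κ_D·e^{−2δ₀D_sep}·P(a)⁻¹e^{−a_Dδ₀d}` («the usual factors multiplied by e^{−2δ₀M}», `D_sep ≧ M` the distance from □̃ to □̃₀ᶜ: the [2]-difference
estimate transferred to the sequences {Ω_j(□)} — DISPLAYED `hD`, cell GAPS G-B9-05, never derived in the tree), then `□̃·D·h_□C_□h_□` has the majorant
`1_{S_□}(a′)·κ_De^{−2δ₀D_sep}B₀Cc₁(δ₀, b−ρ)·e^{−ρδ₀d(a,a′)}`. [cite: Balaban1985BackgroundPropagators, (3.97) p.412] -/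
theorem term397_majorant_blk (blk : X → g.Site) (d : ℕ) (δ₀ aD αst ρ b κD Dsep B₀ C : ℝ) (P : g.Site → ℝ) (S : Finset g.Site)
    (χ h : X → ℝ)
    (hκD : 0 ≤ κD) (hB₀ : 0 ≤ B₀) (hC : 0 ≤ C) (hP : ∀ y, 0 < P y) (hδ₀ : 0 ≤ δ₀) (hρ : 0 ≤ ρ) (hsplit : αst + ρ ≤ aD)
    (htri : B6RandomWalk.Triangle254 (B9Thm34Ext.toB6 g R H)) (hsymm : ∀ a b : g.Site, g.dist a b = g.dist b a)
    (hdnn : ∀ a b : g.Site, 0 ≤ g.dist a b)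
    (hST : B9Ineq347.ScaleTransfer g δ₀ αst C P)
    (h261 : B6RandomWalk.Ineq261 d (B9Thm34Ext.toB6 g R H) δ₀ (b - ρ))
    (hχ1 : ∀ x, |χ x| ≤ 1) (hh1 : ∀ x, |h x| ≤ 1) (hhS : ∀ x, h x ≠ 0 → blk x ∈ S)
    {D Cl : Module.End ℝ (X → ℝ)}
    (hD : B6RandomWalk.HasMajorant (g := B9Thm34Ext.toB6 g R H) blk D
      (fun (a y'' : g.Site) => κD * Real.exp (-(2 * δ₀ * Dsep)) * (P a)⁻¹ * Real.exp (-(aD * δ₀ * g.dist a y''))))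
    (hCl : B6RandomWalk.HasMajorant (g := B9Thm34Ext.toB6 g R H) blk Cl
      (fun (y'' b' : g.Site) => B₀ * P y'' * Real.exp (-(b * δ₀ * g.dist y'' b')))) :
    B6RandomWalk.HasMajorant (g := B9Thm34Ext.toB6 g R H) blk
      (mulOp χ * D * (mulOp h * Cl * mulOp h))
      (fun (a b' : g.Site) => (if b' ∈ S then (1 : ℝ) else 0) *
        (κD * Real.exp (-(2 * δ₀ * Dsep)) * B₀ * C * B6.c1 d δ₀ (b - ρ)) * Real.exp (-(ρ * δ₀ * g.dist a b'))) :=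
  smallFactor_term_majorant_blk blk d δ₀ aD αst ρ b (κD * Real.exp (-(2 * δ₀ * Dsep))) B₀ C P S χ h
    (mul_nonneg hκD (Real.exp_nonneg _)) hB₀ hC hP hδ₀ hρ hsplit htri hsymm hdnn hST h261 hχ1 hh1 hhS hD hCl

/-- ★ **THE SECOND SUM OF (3.95) IS (2.85)-SMALL, AT A GENERAL BLOCK MAP**: the (3.97) terms summed over □ with source-side overlap `≦ N` have the majorant
`N·(κ_De^{−2δ₀D_sep}B₀Cc₁(δ₀, b−ρ))·e^{−ρδ₀d(a,a′)}` — with `e^{−2δ₀D_sep} ≦ (2δ₀M)⁻¹` for `D_sep ≧ M > 0` (`B9Eq395Small.term397_small_factor`) this is the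
printed `O(M⁻¹)`. [cite: Balaban1985BackgroundPropagators, (3.95) p.411 + (3.97) p.412; Balaban1984PropagatorsII, (2.85) p.238] -/
theorem secondSum_majorant_blk (blk : X → g.Site) (d : ℕ) (δ₀ aD αst ρ b κD Dsep B₀ C N : ℝ) (P : g.Site → ℝ) {ι : Type} [Fintype ι]
    (S : ι → Finset g.Site) (χ h : ι → X → ℝ)
    (hκD : 0 ≤ κD) (hB₀ : 0 ≤ B₀) (hC : 0 ≤ C) (hP : ∀ y, 0 < P y) (hδ₀ : 0 ≤ δ₀) (hρ : 0 ≤ ρ) (hsplit : αst + ρ ≤ aD)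
    (htri : B6RandomWalk.Triangle254 (B9Thm34Ext.toB6 g R H)) (hsymm : ∀ a b : g.Site, g.dist a b = g.dist b a)
    (hdnn : ∀ a b : g.Site, 0 ≤ g.dist a b)
    (hST : B9Ineq347.ScaleTransfer g δ₀ αst C P)
    (h261 : B6RandomWalk.Ineq261 d (B9Thm34Ext.toB6 g R H) δ₀ (b - ρ))
    (hχ1 : ∀ i x, |χ i x| ≤ 1) (hh1 : ∀ i x, |h i x| ≤ 1) (hhS : ∀ i x, h i x ≠ 0 → blk x ∈ S i)
    (hcnt : ∀ b' : g.Site, (∑ i, if b' ∈ S i then (1 : ℝ) else 0) ≤ N)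
    (D Cl : ι → Module.End ℝ (X → ℝ))
    (hD : ∀ i, B6RandomWalk.HasMajorant (g := B9Thm34Ext.toB6 g R H) blk (D i)
      (fun (a y'' : g.Site) => κD * Real.exp (-(2 * δ₀ * Dsep)) * (P a)⁻¹ * Real.exp (-(aD * δ₀ * g.dist a y''))))
    (hCl : ∀ i, B6RandomWalk.HasMajorant (g := B9Thm34Ext.toB6 g R H) blk (Cl i)
      (fun (y'' b' : g.Site) => B₀ * P y'' * Real.exp (-(b * δ₀ * g.dist y'' b')))) :
    B6RandomWalk.HasMajorant (g := B9Thm34Ext.toB6 g R H) blk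
      (∑ i, mulOp (χ i) * D i * (mulOp (h i) * Cl i * mulOp (h i)))
      (fun (a b' : g.Site) => N * ((κD * Real.exp (-(2 * δ₀ * Dsep)) * B₀ * C * B6.c1 d δ₀ (b - ρ)) *
        Real.exp (-(ρ * δ₀ * g.dist a b')))) :=
  B9Eq395Small.localizedSum_majorant (R := R) (H := H) blk ρ δ₀ _ N S _
    (mul_nonneg (mul_nonneg (mul_nonneg (mul_nonneg hκD (Real.exp_nonneg _)) hB₀) hC) (B6RandomWalk.c1_nonneg d δ₀ _))
    (fun i => term397_majorant_blk blk d δ₀ aD αst ρ b κD Dsep B₀ C P (S i) (χ i) (h i) hκD hB₀ hC hP hδ₀ hρ hsplit htri hsymm hdnn hST h261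
      (hχ1 i) (hh1 i) (hhS i) (hD i) (hCl i)) hcnt

end Literature.MathematicalPhysics.QuantumFieldTheory.Balaban1983to89.B9Thm39CinvSmallSums
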